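import Mathlib
import Summits.Ventures.PercRepro2.Defs
import Summits.Ventures.PercRepro2.CoinDefs
import Summits.Ventures.PercRepro2.CoinReverse
import Summits.Ventures.PercRepro2.CoinPendantDefs
import Summits.Ventures.PercRepro2.CoinLsmCoreDefs
import Summits.Ventures.PercRepro2.CoinTreeCore
import Summits.Ventures.PercRepro2.CoinOrTailKDefs
import Summits.Ventures.PercRepro2.CoinK2HeadBlindCore

/-!
# Head-blindness from the arc structure, and the out-tree corollary
(blind cell PercRepro2, night-2 g12; proofs/NIGHT2-DARC.md §47.6)

`coreAvoidEvent_blind`: if every arc leaving a NON-ENTRY core vertex lands in the core `U ∪ {a}`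
(«the core talks to the head only through the tail's entries»), then the head's avoidance event
of `W ∪ X` equals that of `(W ∩ ent) ∪ X` for every `X ⊆ {a, w}` — such a vertex has no out-arc
at all once the core coins are switched off, so it reaches nothing but itself.  Hence the
head-blind hypothesis of `darc_of_orTailK2HeadBlind` follows from a structural condition, and the
out-tree corollary `darc_of_orTailTreeK2HeadBlind` (the cluster law of an out-tree core is
log-supermodular, `TreeCore.coreLevel_lsm`).
-/

namespace Summit.Ventures.PercRepro2.Coin

open Classical

section BlindArcs

variable {V : Type*} {E : Type*} [DecidableEq V]
  {arcs : E → Finset (V × V)} {s : V} {U : Finset V} {a : V}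

/-- A vertex whose out-arcs all land in `C` has no out-arc in the reduced map `coreOff arcs C`. -/
lemma no_coreOff_arc_of_into {C : Finset V} {v : V}
    (hout : ∀ e, ∀ xy ∈ arcs e, xy.1 = v → xy.2 ∈ C) {e : E} {y : V}
    (hy : (v, y) ∈ coreOff arcs C e) : False := by
  simp only [coreOff] at hy
  split_ifs at hy with hc
  · exact Finset.notMem_empty _ hy
  · apply hc
    refine ⟨(y, v), ?_, ?_⟩
    · exact mem_revArcs.2 hy
    · exact hout e (v, y) hy rfl

omit [DecidableEq V] in
/-- A vertex without out-arcs reaches only itself. -/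
lemma reach_eq_of_no_out {D : E → Finset (V × V)} {ω : Config E} {v t : V}
    (hno : ∀ e, ∀ y, (v, y) ∈ D e → False) (h : Reach D ω v t) : v = t := by
  rcases Relation.ReflTransGen.cases_head h with rfl | ⟨y, hvy, _⟩
  · rfl
  · obtain ⟨e, _, hvy⟩ := hvy
    exact (hno e y hvy).elim

/-- **Head-blindness from the arc structure.**  If every arc leaving a non-entry vertex of `U`
lands in `U ∪ {a}`, the avoidance event of `W ∪ X` is that of `(W ∩ ent) ∪ X`. -/
theorem coreAvoidEvent_blind {ent : Finset V} {t : V} (htC : t ∉ insert a U)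
    (hout : ∀ v ∈ U, v ∉ ent → ∀ e, ∀ xy ∈ arcs e, xy.1 = v → xy.2 ∈ insert a U)
    {W : Finset V} (hW : W ⊆ U) (X : Finset V) :
    coreAvoidEvent arcs s t (insert a U) (W ∪ X) =
      coreAvoidEvent arcs s t (insert a U) (W ∩ ent ∪ X) := by
  ext ω
  simp only [coreAvoidEvent, Set.mem_setOf_eq]
  constructor
  · intro h v hv
    apply h v
    simp only [Finset.mem_insert, Finset.mem_union, Finset.mem_inter] at hv ⊢
    rcases hv with rfl | ⟨hvW, _⟩ | hvX
    · exact Or.inl rfl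
    · exact Or.inr (Or.inl hvW)
    · exact Or.inr (Or.inr hvX)
  · intro h v hv hreach
    simp only [Finset.mem_insert, Finset.mem_union] at hv
    rcases hv with rfl | hvW | hvX
    · exact h v (Finset.mem_insert_self _ _) hreach
    · by_cases hve : v ∈ ent
      · exact h v (Finset.mem_insert_of_mem (Finset.mem_union_left _ (Finset.mem_inter.2 ⟨hvW, hve⟩)))
          hreach
      · have hvU : v ∈ U := hW hvW
        have hno : ∀ e, ∀ y, (v, y) ∈ coreOff arcs (insert a U) e → False :=
          fun e y hy => no_coreOff_arc_of_into (hout v hvU hve) hy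
        have := reach_eq_of_no_out hno hreach
        subst this
        exact htC (Finset.mem_insert_of_mem hvU)
    · exact h v (Finset.mem_insert_of_mem (Finset.mem_union_right _ hvX)) hreach

end BlindArcs

section TreeCorollary

variable {V : Type*} {E : Type*} [Fintype V] [DecidableEq V] [Fintype E] [DecidableEq E]
  {R : Type*} [Field R] [LinearOrder R] [IsStrictOrderedRing R]
  {arcs : E → Finset (V × V)} {s : V} {U : Finset V} {ent : Finset V} {c : V → E} {a w : V}

/-- **COROLLARY (structural form).**  The head-blind two-entry theorem with the blindness given
by the arc structure: every arc leaving a non-entry vertex of the core lands in `U ∪ {a}`. -/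
theorem darc_of_orTailK2HeadBlind_arcs (pr : E → R) (hp : IsProbVec pr) (hS : SameEnds arcs)
    (h : OrTailK arcs s U ent c a) {r₁ r₂ m₁ m₂ : V} (hm₁ : m₁ ∈ U) (hm₂ : m₂ ∈ U)
    (hr₁ : r₁ ∈ ent) (hr₂ : r₂ ∈ ent) (hent : ∀ r ∈ ent, r = r₁ ∨ r = r₂)
    (hsure : ∀ r ∈ ent, pr (c r) = 1)
    (hν : ∀ W W', W ⊆ U → W' ⊆ U →
      prob pr (coreLevel arcs s U W) * prob pr (coreLevel arcs s U W') ≤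
        prob pr (coreLevel arcs s U (W ∩ W')) * prob pr (coreLevel arcs s U (W ∪ W')))
    {t : V} (htC : t ∉ insert a U) (hts : t ≠ s) (hws : w ≠ s) (hwC : w ∉ insert a U)
    (hout : ∀ v ∈ U, v ∉ ent → ∀ e, ∀ xy ∈ arcs e, xy.1 = v → xy.2 ∈ insert a U)
    (hpos : 0 < prob pr (coreAvoidEvent arcs s t (insert a U) (ent ∪ {a, w}))) :
    DARC pr arcs s {t} m₁ m₂ a w :=
  darc_of_orTailK2HeadBlind pr hp hS h hm₁ hm₂ hr₁ hr₂ hent hsure hν htC hts hws hwC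
    (fun W hW X _ => by rw [coreAvoidEvent_blind htC hout hW X]) hpos

/-- **COROLLARY (out-tree core).**  `U` an out-tree core (`TreeCore`), two sure entries `r₁, r₂`
of the tail (no condition on their ancestry — in particular neither dominated by a marker), ANY
two markers, the core's only exits into the head through the entries, and
`P(ent ∪ {a, w} ↛ t) > 0` ⟹ row 2′DARC at `a → w`. -/
theorem darc_of_orTailTreeK2HeadBlind (pr : E → R) (hp : IsProbVec pr) (hS : SameEnds arcs)
    (h : OrTailK arcs s U ent c a) {c' : V → E} {par : V → V} {rk : V → ℕ}
    (hT : TreeCore arcs s U c' par rk) {r₁ r₂ m₁ m₂ : V} (hm₁ : m₁ ∈ U) (hm₂ : m₂ ∈ U)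
    (hr₁ : r₁ ∈ ent) (hr₂ : r₂ ∈ ent) (hent : ∀ r ∈ ent, r = r₁ ∨ r = r₂)
    (hsure : ∀ r ∈ ent, pr (c r) = 1)
    {t : V} (htC : t ∉ insert a U) (hts : t ≠ s) (hws : w ≠ s) (hwC : w ∉ insert a U)
    (hout : ∀ v ∈ U, v ∉ ent → ∀ e, ∀ xy ∈ arcs e, xy.1 = v → xy.2 ∈ insert a U)
    (hpos : 0 < prob pr (coreAvoidEvent arcs s t (insert a U) (ent ∪ {a, w}))) :
    DARC pr arcs s {t} m₁ m₂ a w :=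
  darc_of_orTailK2HeadBlind_arcs pr hp hS h hm₁ hm₂ hr₁ hr₂ hent hsure (hT.coreLevel_lsm pr hp)
    htC hts hws hwC hout hpos

end TreeCorollary

end Summit.Ventures.PercRepro2.Coin
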